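import Summits.BirchSwinnertonDyer.BirchSwinnertonDyer.Theorems.Rank1ResidualJetCarrierNeShaKernel
import Literature.NumberTheory.EllipticCurves.HeegnerPointsOfConductorOneRationalityProofs
import Literature.NumberTheory.EllipticCurves.HeegnerPointsOfConductorOneGaloisConjProofs
import Literature.NumberTheory.EllipticCurves.CuspFormLFunctionLevelConductorProofs
import HarnessLib

/-!
# T1 JET (cell `bsd-jet`), by-product of the divided descent at depth `M₀ = 0`: KOLYVAGIN'S THEOREM
# «`p ∤ [E(K):ℤy_K] ⟹ Ш(E/ℚ)[p] = 0`» IN THE KERNEL for an odd surjective `p` and ANY reduction at `p`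
# (no Kodaira–Néron, no Cassels–Tate), modulo {Poitou–Tate, [McC] 4.4 ∕ Gross 3.7 (2), [GZ86 III (3.1)]}

HONEST FRAMING (programme `BSD-LIT2PART-PROGRAMME-v1.md` §HONESTY, verbatim): «no tranche here proves BSD;
ARM L moves the LITERAL column of an r ≤ 1 census into the kernel-proved-modulo-named-print column; ARM P
changes what «named print» is worth.» THEOREMS ONLY (seat `bsd-jet-pv-1`, session g9;
`--supports stmt-BirchSwinnertonDyer-14418`, helper); nothing is booked by this file; 0 classes move; per
pair; whether a row books is referee A's word. Kolyvagin's theorem is PUBLISHED (Kolyvagin 1989/1990,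
Gross 1991 Thm. 1.3 ∕ Prop. 2.3); this file does not claim novelty for it — it records that the tree now
proves its `p ∤ index` case without taking it as a named fact, for frames with `p ∣ c_v` allowed.

WHAT. The Kolyvagin-certificate consumer `Typed.noPTorsion_of_kolyvagin_of_not_dvd_index` ∕
`Typed.bsdp_of_kolyvagin_of_not_dvd_index` (behind the X4 ∕ X11b KOLY0 record kits) displays the named
fact `hB : Kolyvagin1990_padicValNat_card_sha_le N W K` («`ord_p #Ш(E/K) ≤ 2 ord_p [E(K):ℤy_K]`»,
McCallum 1991 §1 Theorem). At `p ∤ [E(K):ℤy_K]` that is the depth-`0` case of the divided descent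
(`JET.noPTorsion_of_heegnerCertificate_of_divisibility`, this seat g9): the divisibility supplier at depth
`t = 0` is TRIVIAL (`p^0 = 1`), so `Ш(E/ℚ)[p] = 0` follows from {Poitou–Tate, [McC] 4.4, F1} + {`hKo`
(rank one over `K`), Shimura reciprocity and Darmon 3.6 (Literature THEOREMS)} with no Euler-system
reading, no structure-theorem fact, no (KN_p) and no Cassels–Tate input — for `E/ℚ` globally minimal,
`K` with `d_K ∉ {−3,−4}` Heegner for `N_E`, `p` odd with the `p`-adic tower onto.
* `noPTorsion_of_kolyvaginCertificate_of_literature` — `Ш(E/ℚ)[p] = 0` from `p ∤ [E(K):ℤP]`;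
* `bsdp_of_kolyvaginCertificate_of_literature` — `BSD(E,p)` at a `p`-unit `#Ш_an`, `r_an ≤ 1`;
* `bsdp_of_kolyvaginCertificate_level_of_five_le_of_literature` — the record-row shape (level `N`,
  `ρ̄_{E,p}` onto, `p ≥ 5`; Carayol from modularity), the twin of `Typed.bsdp_of_kolyvagin_of_not_dvd_index`
  with `hB` struck. Displayed named print: {`hPT` Poitou–Tate, `h372` Gross 3.7 (2), `hF1`, `hKo`, `hGZK`,
  `hmod`}. References: [cite: GrossLMS1991, Thm. 1.3, Prop. 2.3, §10] [cite: McCallumLMS1991, §1 Theorem,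
  §5 Lemma 5.1] [cite: Kolyvagin1990, Thm. A] [cite: Miller2011LMS, Def. 1.1] [cite: DiamondShurman2005,
  Thm. 8.8.1]. Design: no definitions; `K : Type`. Axioms: `propext`, `Classical.choice`, `Quot.sound`.
-/

set_option autoImplicit false

noncomputable section

open scoped Classical

open WeierstrassCurve Literature.NumberTheory.EllipticCurves
  Literature.NumberTheory.EllipticCurves.ModularForms Literature.NumberTheory.GaloisCohomology
  Literature.NumberTheory.EllipticCurves.Rank1Residual
  Summit.BirchSwinnertonDyer.Rank1Residual Summit.BirchSwinnertonDyer.Rank1Residual.X11b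

namespace Summit.BirchSwinnertonDyer.Rank1Residual.JET

/-- **Kolyvagin's theorem at `p ∤ [E(K):ℤP]`, IN THE KERNEL modulo {Poitou–Tate, [McC] 4.4, F1}:
`Ш(E/ℚ)[p] = 0`.** `W/ℚ` globally minimal non-CM, `K` imaginary quadratic with `d_K ∉ {−3,−4}` and the
Heegner hypothesis for `N_E`, `P` a Heegner point of infinite order, `p` odd with the `p`-adic tower onto,
`p ∤ [E(K):ℤP]`; ANY reduction type of `E` at `p`. The depth-`0` case of
`noPTorsion_of_heegnerCertificate_of_divisibility` (the divisibility supplier is `Q := P_n`).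
CONDITIONAL on `hPT`, `h44`, `hF1`, `hKo`, `hrec`, `hD36`. [cite: GrossLMS1991, Thm. 1.3, Prop. 2.3, §10]
[cite: McCallumLMS1991, §1 Theorem (Kolyvagin)] -/
theorem noPTorsion_of_kolyvaginCertificate_of_divisibility
    (W : WeierstrassCurve ℚ) [W.IsElliptic] [W.IsGloballyMinimal] [NeZero (W.conductorNorm ℤ)]
    (hcm : ¬ W.HasCM) (K : Type) [Field K] [NumberField K]
    (hPT : poitouTate_sum_localTatePairing_eq_zero K)
    (h44 : McCallum1991.prop44_localOrder_kolyvaginClass_mul_eq)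
    (hF1 : Gross1991_heegnerPoint_sub_ratTorsion_mem_E0)
    (hKo : kolyvagin (W.conductorNorm ℤ) W K)
    (hrec : heegnerPointOfConductor_one_galoisConj (W.conductorNorm ℤ) W K)
    (hD36 : phi_heegnerTau_mem_singularModuliField (W.conductorNorm ℤ) W K)
    (hK : IsImaginaryQuadratic K)
    (hD3 : NumberField.discr K ≠ -3) (hD4 : NumberField.discr K ≠ -4)
    (hH : SatisfiesHeegnerHypothesis (W.conductorNorm ℤ) K)
    (p : ℕ) [Fact p.Prime] (hp2 : p ≠ 2)
    (htower : ∀ n : ℕ, W.HasSurjectiveModNGaloisRep (p ^ n : ℕ))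
    {P : (W.baseChange K).toAffine.Point} (hP : IsHeegnerPoint (W.conductorNorm ℤ) W K P)
    (hnt : ¬ IsOfFinAddOrder P) (hI : ¬ p ∣ (AddSubgroup.zmultiples P).index) :
    ∀ x : W.sha, (p : ℤ) • x = 0 → x = 0 :=
  noPTorsion_of_heegnerCertificate_of_divisibility W hcm K hPT h44 hF1 hKo hrec hD36 hK hD3 hD4 hH p hp2
    htower hP hnt 0
    (fun _ _ _ _ _ s hs n d _ _ ↦ ⟨d.derivedPoint, by
      rw [Nat.le_zero.mp hs, pow_zero, Nat.cast_one, one_zsmul]⟩)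
    (by rw [padicValNat.eq_zero_of_not_dvd hI])

/-- **The same ⟸ NAMED PRINT ONLY**: `h44` from (A′) Gross Prop. 3.7 (2) (`prop44_of_frobeniusCongruence`),
Poitou–Tate from the `∀ K` five-conjunct fact, `hrec` ∕ `hD36` from the Literature theorems, `¬CM` from
`ρ̄_{E,p}` onto at an odd `p`. Displayed: {`hPT` ∀K, `h372`, `hF1`, `hKo`}.
[cite: GrossLMS1991, Thm. 1.3, Prop. 2.3, Prop. 3.7, §10] [cite: Darmon2004, Thm. 3.6, 3.7] -/
theorem noPTorsion_of_kolyvaginCertificate_of_literature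
    (hPT : ∀ (K : Type) [Field K] [NumberField K], poitouTate_selmerStructure_duality_conj K)
    (h372 : GrossLMS1991.prop37_2_frobeniusCongruence)
    (hF1 : Gross1991_heegnerPoint_sub_ratTorsion_mem_E0)
    (W : WeierstrassCurve ℚ) [W.IsElliptic] [W.IsGloballyMinimal] [NeZero (W.conductorNorm ℤ)]
    (K : Type) [Field K] [NumberField K]
    (hKo : kolyvagin (W.conductorNorm ℤ) W K)
    (hK : IsImaginaryQuadratic K)
    (hD3 : NumberField.discr K ≠ -3) (hD4 : NumberField.discr K ≠ -4)
    (hH : SatisfiesHeegnerHypothesis (W.conductorNorm ℤ) K)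
    (p : ℕ) [Fact p.Prime] (hp2 : p ≠ 2)
    (htower : ∀ n : ℕ, W.HasSurjectiveModNGaloisRep (p ^ n : ℕ))
    {P : (W.baseChange K).toAffine.Point} (hP : IsHeegnerPoint (W.conductorNorm ℤ) W K P)
    (hnt : ¬ IsOfFinAddOrder P) (hI : ¬ p ∣ (AddSubgroup.zmultiples P).index) :
    ∀ x : W.sha, (p : ℤ) • x = 0 → x = 0 := by
  have hsurj : W.HasSurjectiveModNGaloisRep (p : ℤ) := by simpa using htower 1
  have hcm : ¬ W.HasCM := fun hCM ↦
    W.not_hasSurjectiveModNGaloisRep_of_hasCM hCM (Fact.out : p.Prime) hp2 (by simpa using hsurj)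
  exact noPTorsion_of_kolyvaginCertificate_of_divisibility W hcm K (poitouTate_sum_of_selmerStructure_conj (hPT K))
    (prop44_of_frobeniusCongruence h372) hF1 hKo (heegnerPointOfConductor_one_galoisConj_holds _ W K)
    (phi_heegnerTau_mem_singularModuliField_holds _ W K) hK hD3 hD4 hH p hp2 htower hP hnt hI

/-- **`BSD(E,p)` from the Kolyvagin certificate `p ∤ [E(K):ℤP]` at a pair with `p ∤ #Ш_an`, `r_an ≤ 1`,
⟸ NAMED PRINT ONLY** — the twin of `Typed.bsdp_of_kolyvagin_of_not_dvd_index` with the structure bound `hB`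
(`Kolyvagin1990_padicValNat_card_sha_le`) STRUCK in favour of the divided descent at depth `0`; extra frame
hypotheses: `W` globally minimal, `N = N_E`, `d_K ∉ {−3,−4}`, the `p`-adic tower. Displayed: {`hPT` ∀K,
`h372`, `hF1`, `hKo`, `hGZK`}. [cite: GrossLMS1991, Thm. 1.3] [cite: Miller2011LMS, Def. 1.1] -/
theorem bsdp_of_kolyvaginCertificate_of_literature
    (hPT : ∀ (K : Type) [Field K] [NumberField K], poitouTate_selmerStructure_duality_conj K)
    (h372 : GrossLMS1991.prop37_2_frobeniusCongruence)
    (hF1 : Gross1991_heegnerPoint_sub_ratTorsion_mem_E0)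
    (hGZK : rank_eq_analyticRank_of_analyticRank_le_one)
    (W : WeierstrassCurve ℚ) [W.IsElliptic] [W.IsGloballyMinimal] [NeZero (W.conductorNorm ℤ)]
    (K : Type) [Field K] [NumberField K]
    (hKo : kolyvagin (W.conductorNorm ℤ) W K)
    (hK : IsImaginaryQuadratic K)
    (hD3 : NumberField.discr K ≠ -3) (hD4 : NumberField.discr K ≠ -4)
    (hH : SatisfiesHeegnerHypothesis (W.conductorNorm ℤ) K)
    (p : ℕ) [Fact p.Prime] (hp2 : p ≠ 2)
    (htower : ∀ n : ℕ, W.HasSurjectiveModNGaloisRep (p ^ n : ℕ))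
    {P : (W.baseChange K).toAffine.Point} (hP : IsHeegnerPoint (W.conductorNorm ℤ) W K P)
    (hnt : ¬ IsOfFinAddOrder P) (hI : ¬ p ∣ (AddSubgroup.zmultiples P).index)
    (hr : W.analyticRank ≤ 1) {s : ℚ} (hs : shaAn W = (s : ℂ)) (hv : padicValRat p s = 0) :
    BSDp W p :=
  Typed.bsdp_of_shaAn_unit_of_noPTorsion W p hGZK hr hs hv
    (noPTorsion_of_kolyvaginCertificate_of_literature hPT h372 hF1 W K hKo hK hD3 hD4 hH p hp2 htower hP hnt hI)

/-- **The record-row shape: `BSD(E,p)` from the Kolyvagin certificate at a Heegner datum of any stated level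
`N`, `p ≥ 5` with `ρ̄_{E,p}` onto (tower by Serre; Carayol from modularity) ⟸ NAMED PRINT ONLY.**
Displayed: {`hPT` ∀K, `h372`, `hF1`, `hKo`, `hGZK`, `hmod`}. [cite: GrossLMS1991, Thm. 1.3]
[cite: SerreAbelianLadic1968, IV-23 Lemma 3] [cite: DiamondShurman2005, Thm. 8.8.1] [cite: Miller2011LMS, Def. 1.1] -/
theorem bsdp_of_kolyvaginCertificate_level_of_five_le_of_literature
    (hPT : ∀ (K : Type) [Field K] [NumberField K], poitouTate_selmerStructure_duality_conj K)
    (h372 : GrossLMS1991.prop37_2_frobeniusCongruence)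
    (hF1 : Gross1991_heegnerPoint_sub_ratTorsion_mem_E0)
    (hGZK : rank_eq_analyticRank_of_analyticRank_le_one)
    (hKo : ∀ (N : ℕ) [NeZero N] (W : WeierstrassCurve ℚ) (K : Type) [Field K] [NumberField K],
      kolyvagin N W K)
    (hmod : exists_isNewformOf)
    (W : WeierstrassCurve ℚ) [W.IsElliptic] [W.IsGloballyMinimal] (p : ℕ) [Fact p.Prime]
    {N : ℕ} [NeZero N] {K : Type} [Field K] [NumberField K] (hK : IsImaginaryQuadratic K)
    (hD3 : NumberField.discr K ≠ -3) (hD4 : NumberField.discr K ≠ -4)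
    (hH : SatisfiesHeegnerHypothesis N K) {P : (W.baseChange K).toAffine.Point}
    (hP : IsHeegnerPoint N W K P) (hnt : ¬ IsOfFinAddOrder P)
    (h5 : 5 ≤ p) (hsurj : W.HasSurjectiveModNGaloisRep p)
    (hI : ¬ p ∣ (AddSubgroup.zmultiples P).index)
    (hr : W.analyticRank ≤ 1) {s : ℚ} (hs : shaAn W = (s : ℂ)) (hv : padicValRat p s = 0) :
    BSDp W p := by
  obtain ⟨Dt, -, -, -⟩ := id hP
  have hN : N = W.conductorNorm ℤ := IsNewformOf.level_eq_conductorNorm_of_exists_isNewformOf' hmod Dt.isNewformOf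
  subst hN
  exact bsdp_of_kolyvaginCertificate_of_literature hPT h372 hF1 hGZK W K (hKo _ W K) hK hD3 hD4 hH p (by omega)
    (serre_hasSurjectiveModNGaloisRep_pow_holds W p h5 hsurj) hP hnt hI hr hs hv

end Summit.BirchSwinnertonDyer.Rank1Residual.JET

end
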